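import Summits.QuantumFields.BalabanUV.T4Continuum.Spine.NE3.PairLandauB8EndSfClassTowers
import HarnessLib

/-!
# T⁴ programme, node NE3 — census G4: THE END's UNIFORM NUMERIC LINES ARE NON-VACUOUS (every d, L ≥ 1), and
# THE END ON B8's SURFACE OVER `sfClass` FOR ALL SUFFICIENTLY SMALL (ε, s₁), b ≤ ε∕2 — printed TYPES and smallness ONLY

Cell `pub-balaban-gaps` (track G2, seat `ne3`; writer prover-pub-balaban-gaps-ne3-g5-0, 2026-08-23), census
`run/shared/lean/pub/pub-balaban-gaps/ne/NE3.md` §3 G4 ∕ §4 R29 ∕ §11.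
WHAT.  `PairLandauB8EndSfClassTowers.ne3EnergyRateWCov_sfClass_towers` (p359230 ✓) displays NE3's local half on B8's surface over
Bałaban's class as ONE implication from three printed-TYPE hypotheses (`PairLandauGaugeB8Avg`, per-pair `LandauCorrectionSupB8`, per-pair
(P♮) on `slicB8`) and ≈ 35 UNIFORM numeric lines in the class radius `ε`, the regularity `b`, B8's constant `s₁`, the [B7]-Prop-4
parameter `α₀` and the letters `P, Q, A_N, A_c, â, Λ`.  Its docstring records «non-vacuity at d = 4, L = 2 NOT checked — census G4».
THIS FILE CHECKS IT, for every `d` and every `L ≥ 1`: **`endLines_exists`** — for every index type `n`, torus size `N` and all reals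
`CP ≥ 0`, `K₀`, `K₁` there is `r > 0` such that for all `0 < ε ≤ r`, `0 ≤ s₁ ≤ r`, `0 ≤ b ≤ ε∕2` the lines hold with the explicit
choices `α₀ = 2ε`, `P = 32K·L^d`, `Q = 64K₁′·L^d` and `A_N, A_c, â, Λ` = their defining right-hand sides (proof: every line is a
STRICT inequality between continuous functions of `(ε, s₁)` at `(0, 0)`, so it holds on a neighbourhood — `ContinuousAt.eventually_lt`;
no numerical value of any constant is used beyond positivity); and the corollary **`ne3EnergyRateWCov_sfClass_small`** = THE END with
its numeric lines DISCHARGED: for `3 ≤ d`, `2 ≤ L`, `1 ≤ N`, `g > 0`, `CP, K₀, K₁ ≥ 0` there is `r > 0` such that for `0 < ε ≤ r`,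
`0 ≤ s₁ ≤ r`, `0 ≤ b ≤ ε∕2`: `PairLandauGaugeB8Avg d (sfClass d L N ε) L N b g s₁ s₂ 1 dom` ∧ per-pair `LandauCorrectionSupB8 (K₀, K₁)`
∧ per-pair `SlicePoincare … (slicB8 …) CP` ⟹ `∃ C, NE3EnergyRateWCov d (sfClass d L N ε) L N b g C s₁ s₂ dom`.
So the covariant root over Bałaban's class follows from [Balaban1985RegularSpaces] Thm 2 + (1.37) ∘ [Balaban1985Variational] Thm 1,
[Balaban1985BackgroundPropagators] (3.42)∕(3.48) and Thm 3.3 TYPES at the pairs, for all sufficiently small class radius, B8 constant and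
regularity — with NO displayed numeric side condition left.  The size of `r` is NOT estimated here (the census records the float value of the
most demanding line: the ℓ¹ level-sum line forces `ε ≤ 1.2·10⁻¹⁶` at d = 4, L = 2 — absurd but positive).

CONTENT (0 sorry, no `def`): `eventually_le_of_continuousAt`, `eventually_lt_of_continuousAt`, **`endLines_exists`**,
**`ne3EnergyRateWCov_sfClass_small`** [folklore].

HONEST FRAMING.  Elementary real analysis (continuity at a point) on OUR displayed lines + one application of p359230; the three
printed-TYPE hypotheses stay hypotheses, OPEN for Bałaban's minimisers; NOTHING of Bałaban's is proved; **NE3 is NOT proved**; spine PROVED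
0∕9; finite T⁴ rung (B)+1 — NOT continuum YM on ℝ⁴, NOT infinite volume, NOT mass gap, NOT Clay.
PLACEMENT: `Summits/QuantumFields/BalabanUV/T4Continuum/Spine/NE3/`.
-/

set_option autoImplicit false

open scoped BigOperators Matrix.Norms.L2Operator Topology

namespace Summit.QuantumFields.BalabanUV.T4Continuum.NE3.EndLinesNonVacuous

open Set Filter
open Literature.MathematicalPhysics.QuantumFieldTheory.Balaban1983to89
open B7Prop1Explicit B7Prop2Explicit B7Prop3Flat MatrixLog
open T4AveragingDeficitWall (IsSkewDir IsUnitaryCfg SmallField)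
open T4AveragingDeficitWallBoundary (IsPeriodicCfg periodBox)
open AveragingDeficitChartCalculus (cavg)
open AveragingDeficitMultiLevelPrep (LevelSmall)
open AveragingDeficitTwoLevelPrep (twoLevelSmall)
open MinimalActionSandwich (IsMinimiser)
open MinimalActionRate (Regular sfClass)
open NE3EnergyWeightedCovShape (NE3EnergyRateWCov)
open NE3SlicePoincareShape (SlicePoincare)
open NE3EnergyRateWSupOfSlicePoincare (cLambda cLambda_pos)
open BlockAverageVaryHolo (nbRad)
open NE3CovariantLineSumsError (Csup)
open ShellMeasureAverageProp4General (C1cov)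
open NE3QbarIterCovLiftPrep (cruxC liftC liftC_nonneg)
open NE3RightInverseSolveLetters (thetaLoc)
open NE3.PairLandauB8Avg (PairLandauGaugeB8Avg slicB8)
open NE3.LandauProjectionSupShape (LandauCorrectionSupB8)
open NE3.PairLandauB8EndSfClassTowers (ne3EnergyRateWCov_sfClass_towers)

noncomputable section

variable {n : Type*} [Fintype n] [DecidableEq n]

/-- A strict inequality between two functions continuous at `0 ∈ ℝ × ℝ` persists, non-strictly, on a neighbourhood. [folklore] -/
theorem eventually_le_of_continuousAt {f g : ℝ × ℝ → ℝ} (hf : ContinuousAt f 0) (hg : ContinuousAt g 0)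
    (h0 : f 0 < g 0) : ∀ᶠ p in 𝓝 (0 : ℝ × ℝ), f p ≤ g p :=
  (hf.eventually_lt hg h0).mono fun _ h => h.le

/-- A strict inequality between two functions continuous at `0 ∈ ℝ × ℝ` persists on a neighbourhood. [folklore] -/
theorem eventually_lt_of_continuousAt {f g : ℝ × ℝ → ℝ} (hf : ContinuousAt f 0) (hg : ContinuousAt g 0)
    (h0 : f 0 < g 0) : ∀ᶠ p in 𝓝 (0 : ℝ × ℝ), f p < g p :=
  hf.eventually_lt hg h0

omit [DecidableEq n] in
/-- **THE END's UNIFORM NUMERIC LINES ARE NON-VACUOUS** (census G4; module docstring): for every `d`, `L ≥ 1`, `N`, index type `n`,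
`CP ≥ 0`, `K₀`, `K₁` there is `r > 0` such that for `0 < ε ≤ r`, `0 ≤ s₁ ≤ r`, `0 ≤ b ≤ ε∕2` ALL numeric hypotheses of
`PairLandauB8EndSfClassTowers.ne3EnergyRateWCov_sfClass_towers` hold for suitable `α₀ P Q AN Ac ah Λ` (displayed verbatim, in the END's order). [folklore] -/
theorem endLines_exists [Nonempty n] (d L N : ℕ) (hL1 : 1 ≤ L) {CP : ℝ} (K₀ K₁ : ℝ) (hCP : 0 ≤ CP) :
    ∃ r : ℝ, 0 < r ∧ ∀ ⦃ε s₁ b : ℝ⦄, 0 < ε → ε ≤ r → 0 ≤ s₁ → s₁ ≤ r → 0 ≤ b → b ≤ ε / 2 →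
      ∃ α₀ P Q AN Ac ah Λ : ℝ,
        b < ε ∧
        ε ≤ 1 ∧
        512 * (d + 1) * (d + 4) * (L : ℝ) ^ 2 * b ≤ 1 ∧
        b + 226 * (8 * (d + 1) * (d + 4)) ^ 2 * b ^ 2 ≤ ε ∧
        16 * (14464 * ((d : ℝ) + 1) ^ 2 * ((d : ℝ) + 4) ^ 2) * ε ≤ 3 ∧
        2 * twoLevelSmall d L * ε ≤ (L : ℝ) ^ 2 ∧
        cruxC d L * ε < 1 ∧
        thetaLoc d L * ε < 1 ∧
        8 * d * (((d : ℝ) - 1) * ε) ^ 2 + 2 * (Fintype.card n * ((4 * (d : ℝ) ^ 2 + 16 * d * (17 * (((d : ℝ) + 1) * ((d : ℝ) + 4)))) * ε) ^ 2) ≤ 1 / 2 ∧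
        0 < α₀ ∧
        C0 d * (2 * α₀) ≤ 1 / 3 ∧
        4 * (2 * α₀) ≤ c2' d L ∧
        ε < α₀ ∧
        Real.exp (4 * (800 * ((d : ℝ) + 1) ^ 2 * ((d : ℝ) + 4)) * α₀) * (1 + 8 * (131072 * ((d : ℝ) + 1) ^ 2) * s₁) ≤ 2 ∧
        4 * s₁ ≤ c3 d L ∧
        16 * (C1cov d * (L : ℝ) ^ 2 * Real.sqrt (d * (2 * (2 * L) + 1) ^ d)) * s₁ ≤ Real.sqrt ((L : ℝ) ^ 2 / (L : ℝ) ^ d) ∧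
        (16 * (d + 1) * (d + 4) * (L : ℝ) ^ 2 * Csup d L * (d * (2 * nbRad d L + 1) ^ d)) * (8 / 3 * (ε / (L : ℝ) ^ 2)) ≤ ((L : ℝ) / (L : ℝ) ^ d) / 2 ∧
        0 ≤ P ∧
        0 ≤ Q ∧
        (32 * (C1cov d * (L : ℝ) ^ 2 * Real.sqrt (d * (2 * (2 * L) + 1) ^ d))) ^ 2 * (L : ℝ) ^ d ≤ P ^ 2 * (L : ℝ) ^ 4 ∧
        64 * (C1cov d * (L : ℝ) ^ 2 * (d * (2 * (2 * (L : ℝ)) + 1) ^ d)) * (L : ℝ) ^ d ≤ Q * (L : ℝ) ^ 2 ∧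
        (liftC d / (1 - cruxC d L * ε) + K₁) * ((8 * (131072 * ((d : ℝ) + 1) ^ 2) * Real.exp (4 * (800 * ((d : ℝ) + 1) ^ 2 * ((d : ℝ) + 4)) * α₀)) * s₁ ^ 2) ≤ AN ∧
        (2 * (liftC d * (17 + 16 * (d : ℝ))) / (1 - cruxC d L * ε) + 2 * ε * K₀) * ((8 * (131072 * ((d : ℝ) + 1) ^ 2) * Real.exp (4 * (800 * ((d : ℝ) + 1) ^ 2 * ((d : ℝ) + 4)) * α₀)) * s₁ ^ 2) ≤ Ac ∧
        3 * ε + 2 * Ac + 8192 * ((s₁ + AN) * AN) + 48 * s₁ ^ 2 + 1300 * ((s₁ + AN) + (1 + 2048 * (s₁ + AN)) * AN) ^ 2 ≤ ah ∧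
        50 * s₁ ≤ 1 ∧
        s₁ + 43 * AN ≤ 1 ∧
        1350 * AN ≤ 1 ∧
        20 * (s₁ + AN) ≤ 1 ∧
        50 * ((1 + 1024 * (s₁ + AN)) * AN) ≤ 1 ∧
        2 * ((2 * (liftC d / (1 - thetaLoc d L * ε)) ^ 2 + 8 * Fintype.card n * ((d : ℝ) * liftC d ^ 2 * (2 * (d : ℝ) + 8) ^ 2 / (1 - thetaLoc d L * ε) ^ 2)) + (2 * (4 * d * (liftC d * (17 + 16 * (d : ℝ))) ^ 2 / (1 - thetaLoc d L * ε) ^ 2) + 128 * Fintype.card (T4AveragingDeficitWall.Plane d) * Fintype.card n * ((d : ℝ) * liftC d ^ 2 * (2 * (d : ℝ) + 8) ^ 2 / (1 - thetaLoc d L * ε) ^ 2))) * P ^ 2 * s₁ ^ 2 ≤ 1 / 2 ∧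
        (1 + 24 * Real.sqrt d * (Real.exp (10 * ((s₁ + AN) + (1 + 2048 * (s₁ + AN)) * AN)) - 1)) ^ 2 + 48 * d * ah ≤ Λ ∧
        112 * (d : ℝ) * ah * CP ≤ 1 / (2 * (Fintype.card n : ℝ)) ∧
        CP * (Real.sqrt Λ - 1) ^ 2 ≤ 1 / 4 ∧
        2 * Λ * (2 * (1 + 4 * Real.sqrt (16 * d + 1)) * ((1 + 2048 * Real.sqrt (16 * d + 1)) * (2 * Real.sqrt ((2 * (liftC d / (1 - thetaLoc d L * ε)) ^ 2 + 8 * Fintype.card n * ((d : ℝ) * liftC d ^ 2 * (2 * (d : ℝ) + 8) ^ 2 / (1 - thetaLoc d L * ε) ^ 2)) + (2 * (4 * d * (liftC d * (17 + 16 * (d : ℝ))) ^ 2 / (1 - thetaLoc d L * ε) ^ 2) + 128 * Fintype.card (T4AveragingDeficitWall.Plane d) * Fintype.card n * ((d : ℝ) * liftC d ^ 2 * (2 * (d : ℝ) + 8) ^ 2 / (1 - thetaLoc d L * ε) ^ 2))) * P * s₁))) + Λ * (2 * (1 + 4 * Real.sqrt (16 * d + 1)) * ((1 + 2048 * Real.sqrt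 (16 * d + 1)) * (2 * Real.sqrt ((2 * (liftC d / (1 - thetaLoc d L * ε)) ^ 2 + 8 * Fintype.card n * ((d : ℝ) * liftC d ^ 2 * (2 * (d : ℝ) + 8) ^ 2 / (1 - thetaLoc d L * ε) ^ 2)) + (2 * (4 * d * (liftC d * (17 + 16 * (d : ℝ))) ^ 2 / (1 - thetaLoc d L * ε) ^ 2) + 128 * Fintype.card (T4AveragingDeficitWall.Plane d) * Fintype.card n * ((d : ℝ) * liftC d ^ 2 * (2 * (d : ℝ) + 8) ^ 2 / (1 - thetaLoc d L * ε) ^ 2))) * P * s₁))) ^ 2 + (2 * (4 * (2 * d * (liftC d * (17 + 16 * (d : ℝ))) / (1 - thetaLoc d L * ε) + 8 * Fintype.card (T4AveragingDeficitWall.Plane d) * Real.sqrt (Fintype.card n * ((d : ℝ) * liftC d ^ 2 * (2 * (d : ℝ) + 8) ^ 2 / (1 - thetaLoc d L * ε) ^ 2) * (N : ℝ) ^ d)) * Q * ah + 8192 * d * (4 * (liftC d / (1 - thetaLoc d L * ε) + 2 * Real.sqrt ((d : ℝ) * Fintype.card n * ((d : ℝ) * liftC d ^ 2 * (2 * (d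 : ℝ) + 8) ^ 2 / (1 - thetaLoc d L * ε) ^ 2) * (N : ℝ) ^ d)) * Q * ah)) + 912 * d * (1806 * (4 * (liftC d / (1 - thetaLoc d L * ε) + 2 * Real.sqrt ((d : ℝ) * Fintype.card n * ((d : ℝ) * liftC d ^ 2 * (2 * (d : ℝ) + 8) ^ 2 / (1 - thetaLoc d L * ε) ^ 2) * (N : ℝ) ^ d)) * Q * ah))) ≤ cLambda n CP Λ / 2 := by
  have hLpos : (0 : ℝ) < L := by exact_mod_cast hL1
  have hL1r : (1 : ℝ) ≤ L := by exact_mod_cast hL1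
  have hcard : (0 : ℝ) < (Fintype.card n : ℝ) := by exact_mod_cast Fintype.card_pos
  have hC1 : 0 < C1cov d := ShellMeasureAverageProp4General.C1cov_pos d
  -- the two constant letters `P`, `Q`
  obtain ⟨P, hP⟩ : ∃ P : ℝ, P = 32 * (C1cov d * (L : ℝ) ^ 2 * Real.sqrt (d * (2 * (2 * L) + 1) ^ d)) * (L : ℝ) ^ d := ⟨_, rfl⟩
  obtain ⟨Q, hQ⟩ : ∃ Q : ℝ, Q = 64 * (C1cov d * (L : ℝ) ^ 2 * (d * (2 * (2 * (L : ℝ)) + 1) ^ d)) * (L : ℝ) ^ d := ⟨_, rfl⟩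
  have hP0 : 0 ≤ P := by rw [hP]; positivity
  have hQ0 : 0 ≤ Q := by rw [hQ]; positivity
  have hPl : (32 * (C1cov d * (L : ℝ) ^ 2 * Real.sqrt (d * (2 * (2 * L) + 1) ^ d))) ^ 2 * (L : ℝ) ^ d ≤ P ^ 2 * (L : ℝ) ^ 4 := by
    have hpow : (L : ℝ) ^ d ≤ ((L : ℝ) ^ d) ^ 2 * (L : ℝ) ^ 4 := by
      rw [← pow_mul, ← pow_add]
      exact pow_le_pow_right₀ hL1r (by omega)
    calc (32 * (C1cov d * (L : ℝ) ^ 2 * Real.sqrt (d * (2 * (2 * L) + 1) ^ d))) ^ 2 * (L : ℝ) ^ d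
        ≤ (32 * (C1cov d * (L : ℝ) ^ 2 * Real.sqrt (d * (2 * (2 * L) + 1) ^ d))) ^ 2 * (((L : ℝ) ^ d) ^ 2 * (L : ℝ) ^ 4) :=
          mul_le_mul_of_nonneg_left hpow (sq_nonneg _)
      _ = P ^ 2 * (L : ℝ) ^ 4 := by rw [hP]; ring
  have hQl : 64 * (C1cov d * (L : ℝ) ^ 2 * (d * (2 * (2 * (L : ℝ)) + 1) ^ d)) * (L : ℝ) ^ d ≤ Q * (L : ℝ) ^ 2 := by
    have hsq : (1 : ℝ) ≤ (L : ℝ) ^ 2 := one_le_pow₀ hL1r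
    have h0 : 0 ≤ 64 * (C1cov d * (L : ℝ) ^ 2 * (d * (2 * (2 * (L : ℝ)) + 1) ^ d)) * (L : ℝ) ^ d := by positivity
    calc 64 * (C1cov d * (L : ℝ) ^ 2 * (d * (2 * (2 * (L : ℝ)) + 1) ^ d)) * (L : ℝ) ^ d
        = (64 * (C1cov d * (L : ℝ) ^ 2 * (d * (2 * (2 * (L : ℝ)) + 1) ^ d)) * (L : ℝ) ^ d) * 1 := (mul_one _).symm
      _ ≤ (64 * (C1cov d * (L : ℝ) ^ 2 * (d * (2 * (2 * (L : ℝ)) + 1) ^ d)) * (L : ℝ) ^ d) * (L : ℝ) ^ 2 :=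
          mul_le_mul_of_nonneg_left hsq h0
      _ = Q * (L : ℝ) ^ 2 := by rw [hQ]
  -- the letters `A_N`, `A_c`, `â`, `Λ` as (opaque) functions of `p = (ε, s₁)`, with `α₀ := 2ε`
  obtain ⟨fAN, hfAN⟩ : ∃ f : ℝ × ℝ → ℝ, f = fun p => (liftC d / (1 - cruxC d L * p.1) + K₁) * ((8 * (131072 * ((d : ℝ) + 1) ^ 2) * Real.exp (4 * (800 * ((d : ℝ) + 1) ^ 2 * ((d : ℝ) + 4)) * (2 * p.1))) * p.2 ^ 2) := ⟨_, rfl⟩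
  obtain ⟨fAc, hfAc⟩ : ∃ f : ℝ × ℝ → ℝ, f = fun p => (2 * (liftC d * (17 + 16 * (d : ℝ))) / (1 - cruxC d L * p.1) + 2 * p.1 * K₀) * ((8 * (131072 * ((d : ℝ) + 1) ^ 2) * Real.exp (4 * (800 * ((d : ℝ) + 1) ^ 2 * ((d : ℝ) + 4)) * (2 * p.1))) * p.2 ^ 2) := ⟨_, rfl⟩
  obtain ⟨fah, hfah⟩ : ∃ f : ℝ × ℝ → ℝ, f = fun p => 3 * p.1 + 2 * (fAc p) + 8192 * ((p.2 + (fAN p)) * (fAN p)) + 48 * p.2 ^ 2 + 1300 * ((p.2 + (fAN p)) + (1 + 2048 * (p.2 + (fAN p))) * (fAN p)) ^ 2 := ⟨_, rfl⟩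
  obtain ⟨fΛ, hfΛ⟩ : ∃ f : ℝ × ℝ → ℝ, f = fun p => (1 + 24 * Real.sqrt d * (Real.exp (10 * ((p.2 + (fAN p)) + (1 + 2048 * (p.2 + (fAN p))) * (fAN p))) - 1)) ^ 2 + 48 * d * (fah p) := ⟨_, rfl⟩
  have hANc : ContinuousAt fAN 0 := by rw [hfAN]; fun_prop (disch := simp)
  have hAcc : ContinuousAt fAc 0 := by rw [hfAc]; fun_prop (disch := simp)
  have hAN0 : fAN 0 = 0 := by rw [hfAN]; simp
  have hAc0 : fAc 0 = 0 := by rw [hfAc]; simp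
  have hahc : ContinuousAt fah 0 := by rw [hfah]; fun_prop
  have hah0 : fah 0 = 0 := by rw [hfah]; simp [hAN0, hAc0]
  have hΛc : ContinuousAt fΛ 0 := by rw [hfΛ]; fun_prop
  have hΛ0 : fΛ 0 = 1 := by rw [hfΛ]; simp [hAN0, hah0]
  have hcΛc : ContinuousAt (fun p : ℝ × ℝ => cLambda n CP (fΛ p) / 2) 0 := by
    unfold cLambda
    fun_prop (disch := positivity)
  have e_hε1 : ∀ᶠ p in 𝓝 (0 : ℝ × ℝ), p.1 ≤ 1 :=
    eventually_le_of_continuousAt (by fun_prop) (by fun_prop) (by simp)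
  have e_hbs2 : ∀ᶠ p in 𝓝 (0 : ℝ × ℝ), 512 * (d + 1) * (d + 4) * (L : ℝ) ^ 2 * p.1 ≤ 1 :=
    eventually_le_of_continuousAt (by fun_prop) (by fun_prop) (by simp)
  have e_hC2 : ∀ᶠ p in 𝓝 (0 : ℝ × ℝ), 226 * (8 * ((d : ℝ) + 1) * (d + 4)) ^ 2 * p.1 ≤ 2 :=
    eventually_le_of_continuousAt (by fun_prop) (by fun_prop) (by simp)
  have e_h1 : ∀ᶠ p in 𝓝 (0 : ℝ × ℝ), 16 * (14464 * ((d : ℝ) + 1) ^ 2 * ((d : ℝ) + 4) ^ 2) * p.1 ≤ 3 :=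
    eventually_le_of_continuousAt (by fun_prop) (by fun_prop) (by simp)
  have e_h2 : ∀ᶠ p in 𝓝 (0 : ℝ × ℝ), 2 * twoLevelSmall d L * p.1 ≤ (L : ℝ) ^ 2 :=
    eventually_le_of_continuousAt (by fun_prop) (by fun_prop) (by simp; positivity)
  have e_hθε : ∀ᶠ p in 𝓝 (0 : ℝ × ℝ), cruxC d L * p.1 < 1 :=
    eventually_lt_of_continuousAt (by fun_prop) (by fun_prop) (by simp)
  have e_hθlε : ∀ᶠ p in 𝓝 (0 : ℝ × ℝ), thetaLoc d L * p.1 < 1 :=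
    eventually_lt_of_continuousAt (by fun_prop) (by fun_prop) (by simp)
  have e_hPsε : ∀ᶠ p in 𝓝 (0 : ℝ × ℝ), 8 * d * (((d : ℝ) - 1) * p.1) ^ 2 + 2 * (Fintype.card n * ((4 * (d : ℝ) ^ 2 + 16 * d * (17 * (((d : ℝ) + 1) * ((d : ℝ) + 4)))) * p.1) ^ 2) ≤ 1 / 2 :=
    eventually_le_of_continuousAt (by fun_prop) (by fun_prop) (by simp)
  have e_hα3 : ∀ᶠ p in 𝓝 (0 : ℝ × ℝ), C0 d * (2 * (2 * p.1)) ≤ 1 / 3 :=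
    eventually_le_of_continuousAt (by fun_prop) (by fun_prop) (by simp)
  have e_hα4 : ∀ᶠ p in 𝓝 (0 : ℝ × ℝ), 4 * (2 * (2 * p.1)) ≤ c2' d L :=
    eventually_le_of_continuousAt (by fun_prop) (by fun_prop) (by simpa using c2'_pos d L hL1)
  have e_hsmall : ∀ᶠ p in 𝓝 (0 : ℝ × ℝ), Real.exp (4 * (800 * ((d : ℝ) + 1) ^ 2 * ((d : ℝ) + 4)) * (2 * p.1)) * (1 + 8 * (131072 * ((d : ℝ) + 1) ^ 2) * p.2) ≤ 2 :=
    eventually_le_of_continuousAt (by fun_prop) (by fun_prop) (by simp)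
  have e_hc₃ : ∀ᶠ p in 𝓝 (0 : ℝ × ℝ), 4 * p.2 ≤ c3 d L :=
    eventually_le_of_continuousAt (by fun_prop) (by fun_prop) (by simpa using c3_pos d hL1)
  have e_hK : ∀ᶠ p in 𝓝 (0 : ℝ × ℝ), 16 * (C1cov d * (L : ℝ) ^ 2 * Real.sqrt (d * (2 * (2 * L) + 1) ^ d)) * p.2 ≤ Real.sqrt ((L : ℝ) ^ 2 / (L : ℝ) ^ d) :=
    eventually_le_of_continuousAt (by fun_prop) (by fun_prop) (by simp; positivity)
  have e_hS1 : ∀ᶠ p in 𝓝 (0 : ℝ × ℝ), (16 * (d + 1) * (d + 4) * (L : ℝ) ^ 2 * Csup d L * (d * (2 * nbRad d L + 1) ^ d)) * (8 / 3 * (p.1 / (L : ℝ) ^ 2)) ≤ ((L : ℝ) / (L : ℝ) ^ d) / 2 :=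
    eventually_le_of_continuousAt (by fun_prop) (by fun_prop) (by simp; positivity)
  have e_hlines₁ : ∀ᶠ p in 𝓝 (0 : ℝ × ℝ), 50 * p.2 ≤ 1 :=
    eventually_le_of_continuousAt (by fun_prop) (by fun_prop) (by simp)
  have e_hlineJ : ∀ᶠ p in 𝓝 (0 : ℝ × ℝ), p.2 + 43 * (fAN p) ≤ 1 :=
    eventually_le_of_continuousAt (by fun_prop) (by fun_prop) (by simp [hAN0])
  have e_hlineN : ∀ᶠ p in 𝓝 (0 : ℝ × ℝ), 1350 * (fAN p) ≤ 1 :=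
    eventually_le_of_continuousAt (by fun_prop) (by fun_prop) (by simp [hAN0])
  have e_hlineα : ∀ᶠ p in 𝓝 (0 : ℝ × ℝ), 20 * (p.2 + (fAN p)) ≤ 1 :=
    eventually_le_of_continuousAt (by fun_prop) (by fun_prop) (by simp [hAN0])
  have e_hlineαN : ∀ᶠ p in 𝓝 (0 : ℝ × ℝ), 50 * ((1 + 1024 * (p.2 + (fAN p))) * (fAN p)) ≤ 1 :=
    eventually_le_of_continuousAt (by fun_prop) (by fun_prop) (by simp [hAN0])
  have e_hρ : ∀ᶠ p in 𝓝 (0 : ℝ × ℝ), 2 * ((2 * (liftC d / (1 - thetaLoc d L * p.1)) ^ 2 + 8 * Fintype.card n * ((d : ℝ) * liftC d ^ 2 * (2 * (d : ℝ) + 8) ^ 2 / (1 - thetaLoc d L * p.1) ^ 2)) + (2 * (4 * d * (liftC d * (17 + 16 * (d : ℝ))) ^ 2 / (1 - thetaLoc d L * p.1) ^ 2) + 128 * Fintype.card (T4AveragingDeficitWall.Plane d) * Fintype.card n * ((d : ℝ) * liftC d ^ 2 * (2 * (d : ℝ) + 8) ^ 2 / (1 - thetaLoc d L * p.1) ^ 2)))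 * P ^ 2 * p.2 ^ 2 ≤ 1 / 2 :=
    eventually_le_of_continuousAt (by fun_prop (disch := simp)) (by fun_prop) (by simp)
  have e_hlineCP : ∀ᶠ p in 𝓝 (0 : ℝ × ℝ), 112 * (d : ℝ) * (fah p) * CP ≤ 1 / (2 * (Fintype.card n : ℝ)) :=
    eventually_le_of_continuousAt (by fun_prop) (by fun_prop) (by simp [hah0]; exact Fintype.card_pos)
  have e_hreg₁ : ∀ᶠ p in 𝓝 (0 : ℝ × ℝ), CP * (Real.sqrt (fΛ p) - 1) ^ 2 ≤ 1 / 4 :=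
    eventually_le_of_continuousAt (by fun_prop) (by fun_prop) (by simp [hΛ0])
  have e_hbudget : ∀ᶠ p in 𝓝 (0 : ℝ × ℝ), 2 * (fΛ p) * (2 * (1 + 4 * Real.sqrt (16 * d + 1)) * ((1 + 2048 * Real.sqrt (16 * d + 1)) * (2 * Real.sqrt ((2 * (liftC d / (1 - thetaLoc d L * p.1)) ^ 2 + 8 * Fintype.card n * ((d : ℝ) * liftC d ^ 2 * (2 * (d : ℝ) + 8) ^ 2 / (1 - thetaLoc d L * p.1) ^ 2)) + (2 * (4 * d * (liftC d * (17 + 16 * (d : ℝ))) ^ 2 / (1 - thetaLoc d L * p.1) ^ 2) + 128 * Fintype.card (T4AveragingDeficitWall.Plane d) * Fintype.card n * ((d : ℝ) * liftC d ^ 2 * (2 * (d : ℝ) + 8) ^ 2 / (1 - thetaLoc d L * p.1) ^ 2))) * P * p.2))) + (fΛ p) * (2 * (1 + 4 * Real.sqrt (16 * d + 1)) * ((1 + 2048 * Real.sqrt (16 * d + 1)) * (2 * Real.sqrt ((2 * (liftC d / (1 - thetaLoc d L * p.1)) ^ 2 + 8 * Fintype.card n * ((d : ℝ) * liftC d ^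 2 * (2 * (d : ℝ) + 8) ^ 2 / (1 - thetaLoc d L * p.1) ^ 2)) + (2 * (4 * d * (liftC d * (17 + 16 * (d : ℝ))) ^ 2 / (1 - thetaLoc d L * p.1) ^ 2) + 128 * Fintype.card (T4AveragingDeficitWall.Plane d) * Fintype.card n * ((d : ℝ) * liftC d ^ 2 * (2 * (d : ℝ) + 8) ^ 2 / (1 - thetaLoc d L * p.1) ^ 2))) * P * p.2))) ^ 2 + (2 * (4 * (2 * d * (liftC d * (17 + 16 * (d : ℝ))) / (1 - thetaLoc d L * p.1) + 8 * Fintype.card (T4AveragingDeficitWall.Plane d) * Real.sqrt (Fintype.card n * ((d : ℝ) * liftC d ^ 2 * (2 * (d : ℝ) + 8) ^ 2 / (1 - thetaLoc d L * p.1) ^ 2) * (N : ℝ) ^ d)) * Q * (fah p) + 8192 * d * (4 * (liftC d / (1 - thetaLoc d L * p.1) + 2 * Real.sqrt ((d : ℝ) * Fintype.card n * ((d : ℝ) * liftC d ^ 2 * (2 * (d : ℝ) + 8) ^ 2 / (1 - thetaLoc d L * p.1) ^ 2) * (N : ℝ) ^ d)) * Q * (fah p))) + 912 * d * (1806 * (4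 * (liftC d / (1 - thetaLoc d L * p.1) + 2 * Real.sqrt ((d : ℝ) * Fintype.card n * ((d : ℝ) * liftC d ^ 2 * (2 * (d : ℝ) + 8) ^ 2 / (1 - thetaLoc d L * p.1) ^ 2) * (N : ℝ) ^ d)) * Q * (fah p)))) ≤ cLambda n CP (fΛ p) / 2 := by
    refine eventually_le_of_continuousAt (g := fun p : ℝ × ℝ => cLambda n CP (fΛ p) / 2) (by fun_prop (disch := simp)) hcΛc ?_
    have hc1 : 0 < cLambda n CP 1 / 2 := half_pos (cLambda_pos (n := n) (Λ := 1) hCP)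
    simpa [hah0, hΛ0] using hc1
  obtain ⟨r, hr0, hr⟩ := Metric.eventually_nhds_iff.1 (e_hε1.and (e_hbs2.and (e_hC2.and (e_h1.and (e_h2.and (e_hθε.and (e_hθlε.and (e_hPsε.and (e_hα3.and (e_hα4.and (e_hsmall.and (e_hc₃.and (e_hK.and (e_hS1.and (e_hlines₁.and (e_hlineJ.and (e_hlineN.and (e_hlineα.and (e_hlineαN.and (e_hρ.and (e_hlineCP.and (e_hreg₁.and (e_hbudget)))))))))))))))))))))))
  refine ⟨r / 2, by linarith, fun ε s₁ b hε hεr hs₁ hs₁r hb hbh => ?_⟩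
  have hdist : dist ((ε, s₁) : ℝ × ℝ) 0 < r := by
    rw [Prod.dist_eq, Real.dist_eq, Real.dist_eq, Prod.fst_zero, Prod.snd_zero, sub_zero, sub_zero,
      abs_of_pos hε, abs_of_nonneg hs₁]
    exact max_lt (by linarith) (by linarith)
  obtain ⟨l_hε1, l_hbs2, l_hC2, l_h1, l_h2, l_hθε, l_hθlε, l_hPsε, l_hα3, l_hα4, l_hsmall, l_hc₃, l_hK, l_hS1, l_hlines₁, l_hlineJ, l_hlineN, l_hlineα, l_hlineαN, l_hρ, l_hlineCP, l_hreg₁, l_hbudget⟩ := hr hdist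
  dsimp only at l_hε1 l_hbs2 l_hC2 l_h1 l_h2 l_hθε l_hθlε l_hPsε l_hα3 l_hα4 l_hsmall l_hc₃ l_hK l_hS1 l_hlines₁ l_hlineJ l_hlineN l_hlineα l_hlineαN l_hρ l_hlineCP l_hreg₁ l_hbudget
  have hbε : b < ε := by linarith
  have hbs : 512 * (d + 1) * (d + 4) * (L : ℝ) ^ 2 * b ≤ 1 :=
    le_trans (mul_le_mul_of_nonneg_left (show b ≤ ε by linarith) (by positivity)) l_hbs2
  have hbε' : b + 226 * (8 * (d + 1) * (d + 4)) ^ 2 * b ^ 2 ≤ ε := by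
    have hbb : b ^ 2 ≤ (ε / 2) * b := by rw [sq]; exact mul_le_mul_of_nonneg_right hbh hb
    have hC0 : (0 : ℝ) ≤ 226 * (8 * (d + 1) * (d + 4)) ^ 2 := by positivity
    have h3 : 226 * (8 * (d + 1) * (d + 4)) ^ 2 * b ^ 2 ≤ b := by
      calc 226 * (8 * (d + 1) * (d + 4)) ^ 2 * b ^ 2 ≤ 226 * (8 * (d + 1) * (d + 4)) ^ 2 * ((ε / 2) * b) :=
            mul_le_mul_of_nonneg_left hbb hC0
        _ = (226 * (8 * (d + 1) * (d + 4)) ^ 2 * ε) / 2 * b := by ring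
        _ ≤ 2 / 2 * b := mul_le_mul_of_nonneg_right (div_le_div_of_nonneg_right l_hC2 (by norm_num)) hb
        _ = b := by ring
    linarith
  refine ⟨2 * ε, P, Q, fAN (ε, s₁), fAc (ε, s₁), fah (ε, s₁), fΛ (ε, s₁), hbε, l_hε1, hbs, hbε', l_h1, l_h2, l_hθε, l_hθlε, l_hPsε,
    by linarith, l_hα3, l_hα4, by linarith, l_hsmall, l_hc₃, l_hK, l_hS1, hP0, hQ0, hPl, hQl, ?_, ?_, ?_, l_hlines₁, l_hlineJ, l_hlineN,
    l_hlineα, l_hlineαN, l_hρ, ?_, l_hlineCP, l_hreg₁, l_hbudget⟩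
  · rw [hfAN]
  · rw [hfAc]
  · rw [hfah]
  · rw [hfΛ]

/-- **THE END ON B8's SURFACE OVER `sfClass` WITH ITS NUMERIC LINES DISCHARGED** (module docstring): for `3 ≤ d`, `2 ≤ L`, `1 ≤ N`,
`g > 0`, `CP, K₀, K₁ ≥ 0` there is `r > 0` such that for every class radius `0 < ε ≤ r`, B8 constant `0 ≤ s₁ ≤ r` and regularity
`0 ≤ b ≤ ε∕2`, the covariant root `NE3EnergyRateWCov d (sfClass d L N ε) L N b g C s₁ s₂ dom` (some `C`) follows from
`PairLandauGaugeB8Avg` ([Balaban1985RegularSpaces] Thm 2 + (1.37) ∘ [Balaban1985Variational] Thm 1 TYPE), per-pair `LandauCorrectionSupB8`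
([Balaban1985BackgroundPropagators] (3.42)∕(3.48) TYPE) and per-pair (P♮) on `slicB8` ([Balaban1985BackgroundPropagators] Thm 3.3 TYPE) —
NOTHING ELSE. [folklore] -/
theorem ne3EnergyRateWCov_sfClass_small [Nonempty n] {d : ℕ} (hd : 3 ≤ d) {L N : ℕ} [NeZero L] [NeZero N] (hL : 2 ≤ L) (hN : 1 ≤ N)
    {g CP K₀ K₁ : ℝ} (hg : 0 < g) (hCP : 0 ≤ CP) (hK₀ : 0 ≤ K₀) (hK₁ : 0 ≤ K₁) :
    ∃ r : ℝ, 0 < r ∧ ∀ ⦃ε s₁ b : ℝ⦄, 0 < ε → ε ≤ r → 0 ≤ s₁ → s₁ ≤ r → 0 ≤ b → b ≤ ε / 2 →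
      ∀ (s₂ : ℝ) {dom : _root_.Set (Site d → Fin d → (Matrix n n ℂ)ˣ)},
        PairLandauGaugeB8Avg d (sfClass d L N ε) L N b g s₁ s₂ 1 dom →
        (∀ j : ℕ, ∀ V ∈ dom, ∀ UB : Site d → Fin d → (Matrix n n ℂ)ˣ, IsMinimiser d (sfClass d L N ε) L N (j + 2) V UB → Regular d L N b g (j + 2) UB → ∀ (hWu : IsUnitaryCfg (cavg L UB)) (hx : 0 ≤ ε / ((L : ℝ) ^ (j + 1)) ^ 2) (hs : LevelSmall d L j (ε / ((L : ℝ) ^ (j + 1)) ^ 2)) (hWx : SmallField (cavg L UB) (ε / ((L : ℝ) ^ (j + 1)) ^ 2)) (hθ : cruxC d L * (((L : ℝ) ^ (j + 1)) ^ 2 * (ε / ((L : ℝ) ^ (j + 1)) ^ 2)) < 1), LandauCorrectionSupB8 hL j hWu hx hs hWx N hθ K₀ K₁) →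
        (∀ j : ℕ, ∀ V ∈ dom, ∀ UB : Site d → Fin d → (Matrix n n ℂ)ˣ, IsMinimiser d (sfClass d L N ε) L N (j + 2) V UB → Regular d L N b g (j + 2) UB → SlicePoincare L (j + 1) (cavg L UB) (slicB8 L N (j + 1) (cavg L UB)) CP (periodBox (N * L ^ (j + 1)))) →
        ∃ C : ℝ, NE3EnergyRateWCov d (sfClass d L N ε) L N b g C s₁ s₂ dom := by
  obtain ⟨r, hr0, hr⟩ := endLines_exists (n := n) d L N (le_trans (by norm_num) hL) K₀ K₁ hCP
  refine ⟨r, hr0, fun ε s₁ b hε hεr hs₁ hs₁r hb hbh s₂ dom hB8 hF5 hP => ?_⟩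
  obtain ⟨α₀, P, Q, AN, Ac, ah, Λ, hbε, hε1, hbs, hbε', h1, h2, hθε, hθlε, hPsε, hα, hα3, hα4, hεα, hsmall, hc₃, hK, hS1, hP0, hQ0,
    hPl, hQl, hAN, hAc, hah, hlines₁, hlineJ, hlineN, hlineα, hlineαN, hρ, hlineΛ, hlineCP, hreg₁, hbudget⟩ :=
    hr hε hεr hs₁ hs₁r hb hbh
  exact ⟨_, ne3EnergyRateWCov_sfClass_towers hd hL hN hb hbε hε1 hg hbs hbε' h1 h2 hθε hθlε hPsε hα hα3 hα4 hεα hs₁ hsmall hc₃ hK hS1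
    hP0 hQ0 hPl hQl hK₀ hK₁ hCP hAN hAc hah hlines₁ hlineJ hlineN hlineα hlineαN hρ hlineΛ hlineCP hreg₁ hbudget hB8 hF5 hP⟩

end

end Summit.QuantumFields.BalabanUV.T4Continuum.NE3.EndLinesNonVacuous
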